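import Summits.ResolutionOfSingularities.ResolutionOfSingularities.Theorems.FrobeniusLadderFRationalResolutionGaloisCompletedObligation
import HarnessLib

/-!
# Crux `FrobeniusLadder.FRationalResolution` (stmt-ResolutionOfSingularities-15317), line `redirect`,
# stub `stub_diagonalizableQuotientResolution` — A CHARACTERISTIC IDEAL OF THE COMPLETE LOCAL RING WITH REGULAR BLOW-UP SETTLES THE TWISTED POINT

`…GaloisCompletedObligation.hloc_of_stable_ideal_adicCompletion` (this generation) asks for an ideal `J` of `Ê = ((B ⊗_K K')_{𝔔'})^` stable under
extensions of the decomposition twists. Here the twists are shown to extend to ring AUTOMORPHISMS of `Ê` (the extension of `1 ⊗ σ⁻¹` is a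
two-sided inverse, by functoriality of `Localization.localRingHom` and of the tree's `adicCompletionMap`), so that ANY CHARACTERISTIC IDEAL of
`Ê` — one mapped into itself by every ring automorphism of `Ê`, e.g. powers / integral closures of `𝔪̂`, or the products of the trace ideals of the
divisorial classes of `Ê` (memo MEMO-15317-leafhand2-g16 §2, «intrinsic class-group centres») — satisfies the stability hypothesis for free:

* `exists_completedTwist_bijective` — for `(1 ⊗ σ) 𝔔' = 𝔔'` there is a BIJECTIVE ring endomorphism `τ` of `Ê` extending `1 ⊗ σ`;
* **`hloc_of_characteristic_ideal_adicCompletion`** — `hloc` at the singular point from the one-point data `(K', 𝔔')` and a proper ideal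
  `J ⊇ (𝔔'Ê)ⁿ` of `Ê` with `θ(J) ⊆ J` for every ring automorphism `θ` of `Ê` and `Bl_J(Spec Ê)` regular.

Honest label: plumbing toward ONE leaf stub (no stub, crux or summit closed); the remaining input is a characteristic `𝔪̂`-primary ideal of the
complete local ring with regular blow-up (a statement about the split toric germ alone). No definitions, no named facts, no sorry.
[cite: Matsumura1987, Thm. 8.11; Thm. 8.14] [cite: StacksProject, Tag 0CDQ; Tag 09EB]
-/

noncomputable section

-- single-problem summit: the doubled namespace component is forced
set_option linter.dupNamespace false

open CategoryTheory AlgebraicGeometry TopologicalSpace TensorProduct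
open Literature.AlgebraicGeometry.Resolution
open Summit.ResolutionOfSingularities.ResolutionOfSingularities.Theorems.FRationalResolution

namespace Summit.ResolutionOfSingularities.ResolutionOfSingularities.Theorems.FRationalResolution.GaloisCharacteristicCentre

/-- The twists `1 ⊗ σ` are bijective and `1 ⊗ σ⁻¹` is a two-sided inverse (pointwise). [folklore] -/
theorem twist_symm_apply {K K' B : Type} [Field K] [Field K'] [Algebra K K'] [CommRing B] [Algebra K B]
    (σ : K' ≃ₐ[K] K') (x : B ⊗[K] K') :
    Algebra.TensorProduct.map (AlgHom.id B B) (σ : K' →ₐ[K] K')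
      (Algebra.TensorProduct.map (AlgHom.id B B) (σ.symm : K' →ₐ[K] K') x) = x := by
  induction x using TensorProduct.induction_on with
  | zero => simp
  | tmul b y => simp [Algebra.TensorProduct.map_tmul]
  | add x y hx hy => simp only [map_add, hx, hy]

/-- Bijectivity of a twist. [folklore] -/
theorem twist_bijective {K K' B : Type} [Field K] [Field K'] [Algebra K K'] [CommRing B] [Algebra K B]
    (σ : K' ≃ₐ[K] K') :
    Function.Bijective (Algebra.TensorProduct.map (AlgHom.id B B) (σ : K' →ₐ[K] K')) := by
  refine Function.bijective_iff_has_inverse.mpr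
    ⟨Algebra.TensorProduct.map (AlgHom.id B B) (σ.symm : K' →ₐ[K] K'), fun x => ?_, fun x => twist_symm_apply σ x⟩
  have h := twist_symm_apply σ.symm x
  rw [AlgEquiv.symm_symm] at h
  exact h

/-- If `(1 ⊗ σ) 𝔔' = 𝔔'` then `𝔔' = (1 ⊗ σ)⁻¹ 𝔔'` (as a `comap`) and `(1 ⊗ σ⁻¹) 𝔔' = 𝔔'`. [folklore] -/
theorem comap_twist_eq_of_map_eq {K K' B : Type} [Field K] [Field K'] [Algebra K K'] [CommRing B] [Algebra K B]
    (𝔔' : Ideal (B ⊗[K] K')) (σ : K' ≃ₐ[K] K')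
    (hσ : 𝔔'.map (Algebra.TensorProduct.map (AlgHom.id B B) (σ : K' →ₐ[K] K')) = 𝔔') :
    𝔔' = 𝔔'.comap (Algebra.TensorProduct.map (AlgHom.id B B) (σ : K' →ₐ[K] K') : B ⊗[K] K' →+* B ⊗[K] K') ∧
      𝔔'.map (Algebra.TensorProduct.map (AlgHom.id B B) (σ.symm : K' →ₐ[K] K')) = 𝔔' := by
  constructor
  · conv_lhs => rw [← Ideal.comap_map_of_bijective
      (Algebra.TensorProduct.map (AlgHom.id B B) (σ : K' →ₐ[K] K') : B ⊗[K] K' →+* B ⊗[K] K')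
      (twist_bijective σ) (I := 𝔔')]
    exact congrArg _ (by exact_mod_cast hσ)
  · have h : (𝔔'.map (Algebra.TensorProduct.map (AlgHom.id B B) (σ : K' →ₐ[K] K'))).map
        (Algebra.TensorProduct.map (AlgHom.id B B) (σ.symm : K' →ₐ[K] K')) = 𝔔' := by
      apply le_antisymm
      · rw [Ideal.map_le_iff_le_comap, Ideal.map_le_iff_le_comap]
        intro x hx
        rw [Ideal.mem_comap, Ideal.mem_comap]
        have hx' : (Algebra.TensorProduct.map (AlgHom.id B B) (σ.symm : K' →ₐ[K] K'))
            ((Algebra.TensorProduct.map (AlgHom.id B B) (σ : K' →ₐ[K] K')) x) = x := by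
          have := twist_symm_apply σ.symm x
          rw [AlgEquiv.symm_symm] at this
          exact this
        rw [hx']
        exact hx
      · intro x hx
        have hx' : x = (Algebra.TensorProduct.map (AlgHom.id B B) (σ.symm : K' →ₐ[K] K'))
            ((Algebra.TensorProduct.map (AlgHom.id B B) (σ : K' →ₐ[K] K')) x) := by
          have := twist_symm_apply σ.symm x
          rw [AlgEquiv.symm_symm] at this
          exact this.symm
        rw [hx']
        exact Ideal.mem_map_of_mem _ (Ideal.mem_map_of_mem _ hx)
    rw [hσ] at h
    exact h

/-- **The decomposition twists extend to BIJECTIVE ring endomorphisms of the complete local ring.** For `σ ∈ Gal(K'/K)` with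
`(1 ⊗ σ) 𝔔' = 𝔔'` there is a bijective `τ : Ê → Ê`, `Ê = ((B ⊗_K K')_{𝔔'})^`, with `τ(b̂) = ((1 ⊗ σ) b)^` (its inverse is the extension of
`1 ⊗ σ⁻¹`; functoriality of `Localization.localRingHom` and of `adicCompletionMap`). [folklore] -/
theorem exists_completedTwist_bijective {K K' B : Type} [Field K] [Field K'] [Algebra K K'] [CommRing B] [Algebra K B]
    (𝔔' : Ideal (B ⊗[K] K')) [h𝔔' : 𝔔'.IsPrime] (σ : K' ≃ₐ[K] K')
    (hσ : 𝔔'.map (Algebra.TensorProduct.map (AlgHom.id B B) (σ : K' →ₐ[K] K')) = 𝔔') :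
    ∃ τ : AdicCompletion (IsLocalRing.maximalIdeal (Localization.AtPrime 𝔔')) (Localization.AtPrime 𝔔') →+*
        AdicCompletion (IsLocalRing.maximalIdeal (Localization.AtPrime 𝔔')) (Localization.AtPrime 𝔔'),
      Function.Bijective τ ∧
      ∀ b : B ⊗[K] K',
        τ (algebraMap (B ⊗[K] K') _ b) =
          algebraMap (B ⊗[K] K') _ (Algebra.TensorProduct.map (AlgHom.id B B) (σ : K' →ₐ[K] K') b) := by
  -- the two twists as ring maps and their localizations
  obtain ⟨hc, hσ'⟩ := comap_twist_eq_of_map_eq 𝔔' σ hσ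
  obtain ⟨hc', -⟩ := comap_twist_eq_of_map_eq 𝔔' σ.symm hσ'
  -- local ring homs map the maximal ideal into itself
  have hloc : ∀ (g : B ⊗[K] K' →+* B ⊗[K] K') (hg : 𝔔' = 𝔔'.comap g),
      (IsLocalRing.maximalIdeal (Localization.AtPrime 𝔔')).map (Localization.localRingHom 𝔔' 𝔔' g hg) ≤
        IsLocalRing.maximalIdeal (Localization.AtPrime 𝔔') := by
    intro g hg
    haveI : IsLocalHom (Localization.localRingHom 𝔔' 𝔔' g hg) := Localization.isLocalHom_localRingHom 𝔔' 𝔔' g hg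
    rw [Ideal.map_le_iff_le_comap]
    intro x hx
    rw [Ideal.mem_comap, IsLocalRing.mem_maximalIdeal]
    exact (map_mem_nonunits_iff _ x).mpr (IsLocalRing.mem_maximalIdeal _ |>.mp hx)
  set tw := Algebra.TensorProduct.map (AlgHom.id B B) (σ : K' →ₐ[K] K') with htw
  set tw' := Algebra.TensorProduct.map (AlgHom.id B B) (σ.symm : K' →ₐ[K] K') with htw'
  set f : B ⊗[K] K' →+* B ⊗[K] K' := (tw : B ⊗[K] K' →+* B ⊗[K] K') with hf
  set f' : B ⊗[K] K' →+* B ⊗[K] K' := (tw' : B ⊗[K] K' →+* B ⊗[K] K') with hf'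
  set φ := Localization.localRingHom 𝔔' 𝔔' f hc with hφ
  set ψ := Localization.localRingHom 𝔔' 𝔔' f' hc' with hψ
  have hff' : ∀ x, f (f' x) = x := fun x => twist_symm_apply σ x
  have hf'f : ∀ x, f' (f x) = x := fun x => by
    have := twist_symm_apply σ.symm x
    rw [AlgEquiv.symm_symm] at this
    exact this
  -- `φ ∘ ψ = id = ψ ∘ φ`
  have hcomp : ∀ (g g' : B ⊗[K] K' →+* B ⊗[K] K') (hg : 𝔔' = 𝔔'.comap g) (hg' : 𝔔' = 𝔔'.comap g')
      (hgg' : ∀ x, g (g' x) = x),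
      (Localization.localRingHom 𝔔' 𝔔' g hg).comp (Localization.localRingHom 𝔔' 𝔔' g' hg') = RingHom.id _ := by
    intro g g' hg hg' hgg'
    have h := Localization.localRingHom_unique (I := 𝔔') 𝔔' (RingHom.id (B ⊗[K] K')) (Ideal.comap_id 𝔔').symm
      (j := (Localization.localRingHom 𝔔' 𝔔' g hg).comp (Localization.localRingHom 𝔔' 𝔔' g' hg')) (fun x => by
        rw [RingHom.comp_apply, Localization.localRingHom_to_map, Localization.localRingHom_to_map, hgg', RingHom.id_apply])
    rw [← h, Localization.localRingHom_id]
  have hφψ : φ.comp ψ = RingHom.id _ := hcomp f f' hc hc' hff'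
  have hψφ : ψ.comp φ = RingHom.id _ := hcomp f' f hc' hc hf'f
  -- complete
  set τ := adicCompletionMap _ _ φ (hloc f hc) with hτ
  set τ' := adicCompletionMap _ _ ψ (hloc f' hc') with hτ'
  have hid : ∀ x : AdicCompletion (IsLocalRing.maximalIdeal (Localization.AtPrime 𝔔')) (Localization.AtPrime 𝔔'),
      adicCompletionMap _ (IsLocalRing.maximalIdeal (Localization.AtPrime 𝔔')) (RingHom.id (Localization.AtPrime 𝔔'))
        (by rw [Ideal.map_id]) x = x :=
    fun x => adicCompletionMap_id _ x
  have hττ' : ∀ x, τ (τ' x) = x := by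
    intro x
    rw [hτ, hτ', adicCompletionMap_comp, adicCompletionMap_congr _ _ hφψ _ (by rw [Ideal.map_id])]
    exact hid x
  have hτ'τ : ∀ x, τ' (τ x) = x := by
    intro x
    rw [hτ, hτ', adicCompletionMap_comp, adicCompletionMap_congr _ _ hψφ _ (by rw [Ideal.map_id])]
    exact hid x
  refine ⟨τ, ⟨Function.LeftInverse.injective hτ'τ, Function.RightInverse.surjective hττ'⟩, fun b => ?_⟩
  rw [AdicCompletion.algebraMap_apply, AdicCompletion.algebraMap_apply, hτ, adicCompletionMap_of, hφ,
    Localization.localRingHom_to_map]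
  rfl

/-- **`hloc` FROM A CHARACTERISTIC IDEAL OF THE COMPLETE LOCAL RING WITH REGULAR BLOW-UP.** One-point data as in
`…GaloisCompletedObligation.hloc_of_stable_ideal_adicCompletion`; the ideal `J ⊇ (𝔔'Ê)ⁿ`, `J ≠ ⊤`, is only asked to be mapped into itself by
every ring AUTOMORPHISM of `Ê` (e.g. any ideal built intrinsically from the ring `Ê`: powers and integral closures of `𝔪̂`, products of trace
ideals of divisorial classes) and to have `Bl_J(Spec Ê)` regular. [cite: Matsumura1987, Thm. 8.11; Thm. 8.14] [cite: StacksProject, Tag 0CDQ; Tag 09EB] -/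
theorem hloc_of_characteristic_ideal_adicCompletion (K : Type) [Field K] (X : Scheme.{0}) [IsIntegral X]
    (f : X ⟶ Spec (.of K)) [LocallyOfFiniteType f]
    {B : Type} [CommRing B] [IsDomain B] [Algebra K B] [Algebra.FiniteType K B]
    (ι : Spec (.of B) ⟶ X) [IsOpenImmersion ι] (hι : ι ≫ f = Spec.map (CommRingCat.ofHom (algebraMap K B)))
    (𝔭 : Ideal B) [h𝔭 : 𝔭.IsMaximal] (h𝔭0 : 𝔭 ≠ ⊥)
    (hsing : ι ⟨𝔭, h𝔭.isPrime⟩ ∉ Scheme.regularLocus X)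
    (hregB : ∀ P : Spec (.of B), P.asIdeal ≠ 𝔭 → P ∈ Scheme.regularLocus (Spec (.of B)))
    (K' : Type) [Field K'] [Algebra K K'] [FiniteDimensional K K'] [IsGalois K K']
    (𝔔' : Ideal (B ⊗[K] K')) [h𝔔' : 𝔔'.IsMaximal] (h𝔔'𝔭 : 𝔔'.comap (algebraMap B (B ⊗[K] K')) = 𝔭)
    (J : Ideal (AdicCompletion (IsLocalRing.maximalIdeal (Localization.AtPrime 𝔔')) (Localization.AtPrime 𝔔')))
    {n : ℕ}
    (hpJ : 𝔔'.map (algebraMap (B ⊗[K] K')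
      (AdicCompletion (IsLocalRing.maximalIdeal (Localization.AtPrime 𝔔')) (Localization.AtPrime 𝔔'))) ^ n ≤ J)
    (hJp : J ≠ ⊤)
    (hchar : ∀ θ : AdicCompletion (IsLocalRing.maximalIdeal (Localization.AtPrime 𝔔')) (Localization.AtPrime 𝔔') ≃+*
        AdicCompletion (IsLocalRing.maximalIdeal (Localization.AtPrime 𝔔')) (Localization.AtPrime 𝔔'), J.map θ ≤ J)
    (hregJ : Scheme.IsRegular (affineBlowup J)) :
    ∃ (V : X.Opens), ι ⟨𝔭, h𝔭.isPrime⟩ ∈ V ∧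
      (∀ t : X, t ∉ Scheme.regularLocus X → t ∈ V → t = ι ⟨𝔭, h𝔭.isPrime⟩) ∧
      ∃ (Y : Scheme.{0}) (ρ : Y ⟶ V), IsProper ρ ∧ Scheme.IsRegular Y ∧
        IsIso (ρ ∣_ (V.ι ⁻¹ᵁ ⟨Scheme.regularLocus X, isOpen_regularLocus_of_locallyOfFiniteType_field f⟩)) ∧
        Dense ((ρ ⁻¹ᵁ (V.ι ⁻¹ᵁ ⟨Scheme.regularLocus X,
          isOpen_regularLocus_of_locallyOfFiniteType_field f⟩) : Y.Opens) : Set Y) := by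
  refine GaloisCompletedObligation.hloc_of_stable_ideal_adicCompletion K X f ι hι 𝔭 h𝔭0 hsing hregB K' 𝔔' h𝔔'𝔭 J hpJ hJp
    (fun σ hσ => ?_) hregJ
  obtain ⟨τ, hbij, hτ⟩ := exists_completedTwist_bijective 𝔔' σ hσ
  refine ⟨τ, hτ, ?_⟩
  rw [Ideal.map_le_iff_le_comap]
  intro x hx
  rw [Ideal.mem_comap]
  have h := hchar (RingEquiv.ofBijective τ hbij) (Ideal.mem_map_of_mem (RingEquiv.ofBijective τ hbij) hx)
  rwa [RingEquiv.ofBijective_apply] at h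

end Summit.ResolutionOfSingularities.ResolutionOfSingularities.Theorems.FRationalResolution.GaloisCharacteristicCentre

end
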